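import Literature.Computability.AlgebraicComplexity.NoncommutativeCircuits
import Summits.ValiantsHypothesis.ValiantsHypothesis.Theorems.NcPerWordTensor
import Summits.ValiantsHypothesis.ValiantsHypothesis.Theorems.NisanDeterminant
import HarnessLib

/-!
# The word tensor of the ordered (Cayley) determinant `ncDetPoly F n` IS Nisan's signed tensor `detWord n`

Decomposition workshop `decomp-valiant`, lens 6 «restricted-models lifting axis», gen 5 (determinant face
`Theorems/NcDeterminantFace.lean` of the node `CommutativityDial`): the decided rung beneath the piece
`NcDetHard` ("the Cayley determinant has no polynomial-size noncommutative circuits") is Nisan's theorem for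
the determinant, landed in gen 4 on the SIGNED WORD TENSOR `NisanDeterminant.detWord n` (nc-ABP width
`= C(n, ⌊n/2⌋)` exactly, `NisanDeterminant.ncAbpWidth_detWord`). This file proves that `detWord n` is
LITERALLY the coefficient tensor of the Literature free-algebra element `ncDetPoly F n`
(`Literature/…/NoncommutativeCircuits.lean`) that `NcDetHard` / `DetLift` / `AS10_thm_10` speak about — the
determinant twin of `Theorems/NcPerWordTensor.lean`:

* `coeff_equiv_ncDetPoly` — the coefficient of a word `u` in `ncDetPoly F n` is
  `Σ_{π : u = (π 0,0)⋯(π (n-1),n-1)} sign π` (at most one term);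
* `coeff_equiv_ncDetPoly_ofFn` — on words of length `n`: `detWord n (rows of w)` if `w` is column-consistent,
  `0` otherwise; `coeff_equiv_ncDetPoly_of_length_ne` — other lengths do not occur;
* `coeff_equiv_ncDetPoly_rows` — composing with `t ↦ (w₁ t, t)` recovers `detWord n w₁` on the nose.

Hence every sequential flattening of `ncDetPoly`'s word tensor is the corresponding flattening of `detWord n`
bordered by zeros, and Nisan's rank `C(n,a)` / width `C(n,⌊n/2⌋)` statements (`NisanDeterminant`) are
statements about the object of the determinant face. HONEST FRAMING: bookkeeping; nothing here bears on
`VP ≠ VNP`; the gap between this DECIDED nc-ABP rung and the OPEN nc-CIRCUIT piece `NcDetHard` is the whole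
content (AS10 §1).

## References
* [Nisan1991Noncommutative] N. Nisan, Lower bounds for non-commutative computation, STOC 1991, §4 (Thm 1
  for the determinant).
* [ArvindSrinivasan2010] V. Arvind, S. Srinivasan, On the hardness of the noncommutative determinant,
  STOC 2010 (arXiv:0910.2370), §1 (Cayley determinant).
-/

namespace Summit.ValiantsHypothesis.ValiantsHypothesis.Theorems.NcDetWordTensor

open Literature.Computability.AlgebraicComplexity (ncDetPoly)
open Summit.ValiantsHypothesis.ValiantsHypothesis.Theorems.NcPerWordTensor (equiv_prod_ofFn_ι ofList_perm_eq_iff)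
open Summit.ValiantsHypothesis.ValiantsHypothesis.Theorems.NisanDeterminant (detWord wordSign)

universe u

variable {F : Type u} [Field F]

/-- **Coefficients of the ordered determinant**: the coefficient of the word `u` in `ncDetPoly F n` is the
signed count of permutations `π` whose column-ordered word `(π 0,0)(π 1,1)⋯` equals `u`.
[cite: Nisan1991Noncommutative, §4] -/
theorem coeff_equiv_ncDetPoly (n : ℕ) (u : FreeMonoid (Fin n × Fin n)) :
    (FreeAlgebra.equivMonoidAlgebraFreeMonoid (ncDetPoly F n)).coeff u =
      ∑ π : Equiv.Perm (Fin n),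
        if List.ofFn (fun t => (π t, t)) = FreeMonoid.toList u
          then ((Equiv.Perm.sign π : ℤ) : F) else 0 := by
  classical
  unfold ncDetPoly
  simp only [map_sum, Units.smul_def, map_zsmul, equiv_prod_ofFn_ι, MonoidAlgebra.coeff_sum,
    Finsupp.finsetSum_apply]
  refine Finset.sum_congr rfl fun π _ => ?_
  rw [MonoidAlgebra.coeff_smul, MonoidAlgebra.coeff_single, Finsupp.smul_apply, Finsupp.single_apply,
    smul_ite, smul_zero, zsmul_eq_mul, mul_one]
  exact if_congr ⟨fun h => by rw [← h]; rfl, fun h => by rw [h]; rfl⟩ rfl rfl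

/-- Signed counting of permutations with prescribed values: `Σ_{π : ⇑π = w₁} sign π = wordSign n w₁`
(`sign` of `w₁` if it is a permutation, else `0`). [cite: Nisan1991Noncommutative, §4] -/
theorem sum_perm_sign_indicator {n : ℕ} (w₁ : Fin n → Fin n) :
    (∑ π : Equiv.Perm (Fin n), if ⇑π = w₁ then ((Equiv.Perm.sign π : ℤ) : F) else 0) =
      wordSign F n w₁ := by
  unfold wordSign
  by_cases hbij : Function.Bijective w₁
  · rw [dif_pos hbij]
    have key : ∀ π : Equiv.Perm (Fin n), (⇑π = w₁) ↔ π = Equiv.ofBijective w₁ hbij := fun π =>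
      ⟨fun h => Equiv.ext fun t => by simp [← h], fun h => by subst h; rfl⟩
    simp_rw [key]
    simp
  · rw [dif_neg hbij]
    refine Finset.sum_eq_zero fun π _ => ?_
    rw [if_neg]
    intro h
    exact hbij (h ▸ π.bijective)

/-- **THE BRIDGE**: on words of length `n`, the word tensor of `ncDetPoly F n` is Nisan's signed tensor
`detWord n` on column-consistent words and `0` elsewhere. [cite: Nisan1991Noncommutative, §4] -/
theorem coeff_equiv_ncDetPoly_ofFn (n : ℕ) (w : Fin n → Fin n × Fin n) :
    (FreeAlgebra.equivMonoidAlgebraFreeMonoid (ncDetPoly F n)).coeff (FreeMonoid.ofList (List.ofFn w)) =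
      if ∀ t, (w t).2 = t then detWord F n (fun t => (w t).1) else 0 := by
  rw [coeff_equiv_ncDetPoly]
  have hsum : ∀ π : Equiv.Perm (Fin n),
      (if List.ofFn (fun t => (π t, t)) = FreeMonoid.toList (FreeMonoid.ofList (List.ofFn w))
        then ((Equiv.Perm.sign π : ℤ) : F) else 0) =
        if (∀ t, (w t).2 = t) ∧ ⇑π = fun t => (w t).1 then ((Equiv.Perm.sign π : ℤ) : F) else 0 :=
    fun π => if_congr (ofList_perm_eq_iff π w) rfl rfl
  rw [Finset.sum_congr rfl fun π _ => hsum π]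
  by_cases h2 : ∀ t, (w t).2 = t
  · rw [if_pos h2, detWord, ← sum_perm_sign_indicator (F := F) (fun t => (w t).1)]
    exact Finset.sum_congr rfl fun π _ => if_congr (and_iff_right h2) rfl rfl
  · rw [if_neg h2]
    exact Finset.sum_eq_zero fun π _ => if_neg fun h => h2 h.1

/-- Words whose length is not `n` do not occur in `ncDetPoly F n`. [cite: Nisan1991Noncommutative, §4] -/
theorem coeff_equiv_ncDetPoly_of_length_ne (n : ℕ) (u : FreeMonoid (Fin n × Fin n))
    (hu : (FreeMonoid.toList u).length ≠ n) :
    (FreeAlgebra.equivMonoidAlgebraFreeMonoid (ncDetPoly F n)).coeff u = 0 := by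
  rw [coeff_equiv_ncDetPoly]
  refine Finset.sum_eq_zero fun π _ => ?_
  rw [if_neg]
  intro h
  exact hu (by rw [← h, List.length_ofFn])

/-- Column-consistent reading: composing with the letter map `t ↦ (w₁ t, t)` recovers `detWord` on the
nose — the tensor `NisanDeterminant` decides (`ncAbpWidth_detWord = C(n,⌊n/2⌋)`) is the word tensor of the
determinant face's target `ncDetPoly`. [cite: Nisan1991Noncommutative, §4] -/
theorem coeff_equiv_ncDetPoly_rows (n : ℕ) (w₁ : Fin n → Fin n) :
    (FreeAlgebra.equivMonoidAlgebraFreeMonoid (ncDetPoly F n)).coeff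
        (FreeMonoid.ofList (List.ofFn fun t => (w₁ t, t))) = detWord F n w₁ := by
  rw [coeff_equiv_ncDetPoly_ofFn]
  simp

/-- Nonvanishing pattern: the coefficient of the column-consistent word with rows `w₁` is nonzero iff `w₁`
is a permutation — the SUPPORT of the Cayley determinant's word tensor equals that of the Cayley permanent's
(`NcPerWordTensor.coeff_equiv_ncPerPoly_rows`, `perWord`), which is why Nisan's measure is det-blind.
[cite: Nisan1991Noncommutative, §4] -/
theorem coeff_equiv_ncDetPoly_rows_ne_zero_iff (n : ℕ) (w₁ : Fin n → Fin n) :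
    (FreeAlgebra.equivMonoidAlgebraFreeMonoid (ncDetPoly F n)).coeff
        (FreeMonoid.ofList (List.ofFn fun t => (w₁ t, t))) ≠ 0 ↔ Function.Bijective w₁ := by
  rw [coeff_equiv_ncDetPoly_rows, detWord]
  constructor
  · intro h
    by_contra hb
    exact h (NisanDeterminant.wordSign_of_not_injective fun hi =>
      hb (Finite.injective_iff_bijective.mp hi))
  · exact fun hb => NisanDeterminant.wordSign_ne_zero hb

end Summit.ValiantsHypothesis.ValiantsHypothesis.Theorems.NcDetWordTensor
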